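import Literature.AlgebraicGeometry.Frobenioids.ModelFrobenioidTypeBridge
import Literature.AnabelianGeometry.EtaleTheta.TemperedFrobenioidCor38Sub
import HarnessLib

/-!
# [EtTh] Cor. 3.8, proof row C38-L04 `PreservesOTri`: the Frobenius-degree half holds at every
# Frobenius-trivial object, for EVERY record `h : Cor38Hyp C₁ C₂` (degree rigidity from Frobenius-normalization)

S. Mochizuki, *The étale theta function and its Frobenioid-theoretic manifestations*, Publ. RIMS **45**
(2009), Cor. 3.8, proof, PDF p. 81 l. 5–8: "it follows that `Ψ` preserves the submonoids '`O^▷(−)`'"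
[cite: MochizukiEtTh2009, Cor 3.8 p.81]; S. Mochizuki, *The geometry of Frobenioids I*, Kyushu J. Math.
**62** (2008), Def. 1.2 (iv) p. 23 ("Frobenius-normalized": `α^d ∘ φ = φ ∘ α` for `α ∈ O^▷(A)` and `φ` a
base-identity endomorphism of Frobenius degree `d`) and Thm. 5.2 (i) p. 100 (model Frobenioids)
[cite: MochizukiFrdI2008, Def. 1.2 (iv) p.23].

abc-iut cell, block F, seat abc-iut-f-133 (gen 2), tranche 133 (rows F-2809 `PreservesPreSteps`, F-2812
`PreservesOTri` of `TemperedFrobenioidCor38Sub.lean`; instance forms PROVED by abc-iut-f-001, p430635).  This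
PROOF-ONLY file records a KERNEL piece of the closure-side census of F-2812 / F-2815: with NO hypothesis on the
equivalence `Ψ` (indeed for an arbitrary functor), the FROBENIUS-DEGREE conjunct of "`Ψ` preserves `O^▷(−)`"
holds at every object `A` that admits a base-identity endomorphism of Frobenius degree `≠ 1` — in particular
at every Frobenius-trivial object ([FrdI] Def. 1.2 (iv)) and at every object `(A_D, 0)` of the model
Frobenioid.  Mechanism: the tempered Frobenioid's category is a model Frobenioid ([EtTh] Def. 3.6 (ii) /
[FrdI] Thm. 5.2 (i)), hence of Frobenius-normalized type (tree: `ModelFrobenioid.data_isOfFrobeniusNormalizedType`):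
`α^d ∘ φ = φ ∘ α`; a functor transports this identity to `End(Ψ A)`, and the Frobenius degree
`End(Ψ A) → ℕ_{≥1}` is multiplicative, so `deg(Ψα)^d = deg(Ψα)`, whence `deg(Ψα) = 1` as soon as `d ≥ 2`.
Consequently the bare universal closure of F-2812 can fail ONLY through its base-identity conjunct
(`Base(Ψ α) = id`; cf. [FrdI] Ex. 3.9 "non-preservation of `O^▷(−)`", kurims p. 72) or at objects with no
non-linear base-identity endomorphism.  Nothing here decides a universal closure; no definition is introduced.
HONEST FRAMING: refereed pre-IUT material; nothing here bears on [IUTchIII] Cor. 3.12; typed ≠ proved.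
-/

namespace Literature.AnabelianGeometry.EtaleTheta

open CategoryTheory Opposite Literature.AlgebraicGeometry.Frobenioids

universe u₀ v₀ u v w

/-! ### Degree rigidity of `O^▷(A)` under an arbitrary functor, from Frobenius-normalization ([FrdI] Def. 1.2 (iv)) -/

section General

variable {E₁ : Type*} [Category E₁] {B₁ : Type*} [Category B₁] {E₂ : Type*} [Category E₂] {B₂ : Type*}
  [Category B₂] (S₁ : PreFrobenioidData E₁ B₁) (S₂ : PreFrobenioidData E₂ B₂)

/-- The Frobenius degree of a power of an endomorphism: `deg_Fr(f^n) = deg_Fr(f)^n` (Remark 1.1.1: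
degrees multiply). [cite: MochizukiFrdI2008, Rem. 1.1.1 p.21] -/
theorem degFr_pow_end {A : E₁} (f : End A) (n : ℕ) : S₁.degFr (f ^ n) = S₁.degFr f ^ n := by
  induction n with
  | zero => rw [pow_zero, pow_zero, End.one_def, S₁.degFr_id]
  | succ n ih => rw [pow_succ, S₁.degFr_mul, ih, pow_succ, mul_comm]

/-- In `ℕ_{≥1}`, `x ^ d = x` with `d ≠ 1` forces `x = 1`. [folklore] -/
private theorem pnat_eq_one_of_pow_eq {x : ℕ+} {d : ℕ} (hd : d ≠ 1) (h : x ^ d = x) : x = 1 := by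
  have hx : 0 < (x : ℕ) := x.pos
  have hnat : (x : ℕ) ^ d = x := by exact_mod_cast congrArg PNat.val h
  rcases Nat.lt_or_ge d 1 with hd0 | hd1
  · have : d = 0 := by omega
    subst this
    rw [pow_zero] at hnat
    exact PNat.coe_inj.mp (by simpa using hnat.symm)
  · by_contra hne
    have hx2 : 2 ≤ (x : ℕ) := by
      have : (x : ℕ) ≠ 1 := fun h1 => hne (PNat.coe_inj.mp (by simpa using h1))
      omega
    have hd2 : 2 ≤ d := by omega
    have : (x : ℕ) ^ 2 ≤ (x : ℕ) ^ d := Nat.pow_le_pow_right hx hd2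
    have hsq : (x : ℕ) < (x : ℕ) ^ 2 := by nlinarith
    omega

/-- **Degree rigidity of `O^▷(A)` under a functor.**  If `A` is Frobenius-normalized for the operations
`S₁` ([FrdI] Def. 1.2 (iv): `α^d ∘ φ = φ ∘ α`) and admits a base-identity endomorphism `φ` of Frobenius
degree `d ≠ 1`, then ANY functor `F` carries every `α ∈ O^▷(A)` to a LINEAR endomorphism of `F A` for ANY
operations `S₂` on the target: transporting the identity and taking degrees gives `deg(Fα)^d = deg(Fα)`.
[cite: MochizukiFrdI2008, Def. 1.2 (iv) p.23] -/
theorem isLinear_map_of_isFrobeniusNormalized (F : E₁ ⥤ E₂) {A : E₁} (hA : S₁.IsFrobeniusNormalized A)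
    {φ : End A} (hφ : S₁.IsBaseIdentity φ) (hd : S₁.degFr φ ≠ 1) {α : End A}
    (hα : α ∈ S₁.endSubmonoid A) : S₂.IsLinear (F.map α) := by
  have key : α ^ (S₁.degFr φ : ℕ) * φ = φ * α := hA φ hφ α hα
  have hmap := congrArg (F.mapEnd A) key
  rw [map_mul, map_pow, map_mul] at hmap
  have hdeg := congrArg S₂.degFr hmap
  rw [S₂.degFr_mul, S₂.degFr_mul, degFr_pow_end] at hdeg
  -- `hdeg : deg(Fφ) * deg(Fα)^d = deg(Fα) * deg(Fφ)`
  have h' : S₂.degFr ((F.mapEnd A) α) ^ (S₁.degFr φ : ℕ) = S₂.degFr ((F.mapEnd A) α) := by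
    have := hdeg
    rw [mul_comm] at this
    exact mul_right_cancel this
  have hd' : (S₁.degFr φ : ℕ) ≠ 1 := fun h1 => hd (PNat.coe_inj.mp (by simpa using h1))
  exact pnat_eq_one_of_pow_eq hd' h'

/-- At a **Frobenius-trivial** object ([FrdI] Def. 1.2 (iv): a section `ζ : ℕ_{≥1} → End(A)` of the degree by
base-identity endomorphisms of Frobenius type) of a pre-Frobenioid of Frobenius-normalized type, every
functor carries `O^▷(A)` into the linear endomorphisms of the image. [cite: MochizukiFrdI2008, Def. 1.2 (iv) p.23] -/
theorem isLinear_map_of_isFrobeniusTrivial (F : E₁ ⥤ E₂) (hFN : S₁.IsOfFrobeniusNormalizedType) {A : E₁}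
    (hA : S₁.IsFrobeniusTrivial A) {α : End A} (hα : α ∈ S₁.endSubmonoid A) :
    S₂.IsLinear (F.map α) := by
  obtain ⟨ζ, hζ⟩ := hA
  obtain ⟨hdeg, hbase, -⟩ := hζ 2
  refine isLinear_map_of_isFrobeniusNormalized S₁ S₂ F (hFN.obj A) hbase ?_ hα
  rw [hdeg]; decide

end General

/-! ### The rows of [EtTh] Cor. 3.8: C38-L04 `PreservesOTri`, degree half, for every `h : Cor38Hyp C₁ C₂` -/

section Rows

variable {D₀ : Type u₀} [Category.{v₀} D₀] {V : FrdIMonoidStub.{w}} {T : RealifiedDivisorMonoids (D₀ := D₀) V}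
  {D : Type u} [Category.{v} D] {VD : FrdICatStub.{u, v, w} D}
  {D₀' : Type u₀} [Category.{v₀} D₀'] {T' : RealifiedDivisorMonoids (D₀ := D₀') V}
  {D' : Type u} [Category.{v} D'] {VD' : FrdICatStub.{u, v, w} D'}
  {C₁ : TemperedFrobenioid T D VD} {C₂ : TemperedFrobenioid T' D' VD'}

/-- The Frobenioid of a tempered Frobenioid is of Frobenius-normalized type (it IS a model Frobenioid,
[EtTh] Def. 3.6 (ii) / [FrdI] Thm. 5.2 (i); tree `ModelFrobenioid.data_isOfFrobeniusNormalizedType`).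
[cite: MochizukiEtTh2009, Def 3.6 p.77] -/
theorem TemperedFrobenioid.opsData_isOfFrobeniusNormalizedType (C : TemperedFrobenioid T D VD) :
    C.opsData.IsOfFrobeniusNormalizedType :=
  ModelFrobenioid.data_isOfFrobeniusNormalizedType

namespace Cor38Hyp

variable (h : Cor38Hyp C₁ C₂)

/-- **C38-L04, degree half, unconditional in `h`**: for EVERY record `h : Cor38Hyp C₁ C₂` and every object
`A` of `C₁` admitting a base-identity endomorphism `φ` with `deg_Fr(φ) ≠ 1`, `Ψ` carries `O^▷(A)` into the
LINEAR endomorphisms of `Ψ A` (no slimness, no FSMFF-ness, no non-dilation used).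
[cite: MochizukiEtTh2009, Cor 3.8 p.81] -/
theorem isLinear_map_of_mem_endSubmonoid {A : C₁.category} {φ : End A} (hφ : C₁.opsData.IsBaseIdentity φ)
    (hd : C₁.opsData.degFr φ ≠ 1) {α : End A} (hα : α ∈ C₁.opsData.endSubmonoid A) :
    C₂.opsData.IsLinear (h.Ψ.functor.map α) :=
  isLinear_map_of_isFrobeniusNormalized C₁.opsData C₂.opsData h.Ψ.functor
    (C₁.opsData_isOfFrobeniusNormalizedType.obj A) hφ hd hα

/-- The same for `Ψ⁻¹`. [cite: MochizukiEtTh2009, Cor 3.8 p.81] -/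
theorem isLinear_inverse_map_of_mem_endSubmonoid {A : C₂.category} {φ : End A}
    (hφ : C₂.opsData.IsBaseIdentity φ) (hd : C₂.opsData.degFr φ ≠ 1) {α : End A}
    (hα : α ∈ C₂.opsData.endSubmonoid A) : C₁.opsData.IsLinear (h.Ψ.inverse.map α) :=
  isLinear_map_of_isFrobeniusNormalized C₂.opsData C₁.opsData h.Ψ.inverse
    (C₂.opsData_isOfFrobeniusNormalizedType.obj A) hφ hd hα

/-- **C38-L04 at Frobenius-trivial objects, degree half, for every `h`**: `Ψ` and `Ψ⁻¹` carry `O^▷(A)` of a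
Frobenius-trivial object `A` into linear endomorphisms.  (The base-identity half of `PreservesOTri` is NOT
claimed: it is exactly what [FrdI] Ex. 3.9 violates over a non-slim base.) [cite: MochizukiEtTh2009, Cor 3.8 p.81] -/
theorem isLinear_map_of_isFrobeniusTrivial_both :
    (∀ ⦃A : C₁.category⦄, C₁.opsData.IsFrobeniusTrivial A → ∀ α ∈ C₁.opsData.endSubmonoid A,
        C₂.opsData.IsLinear (h.Ψ.functor.map α)) ∧
      ∀ ⦃A : C₂.category⦄, C₂.opsData.IsFrobeniusTrivial A → ∀ α ∈ C₂.opsData.endSubmonoid A,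
        C₁.opsData.IsLinear (h.Ψ.inverse.map α) :=
  ⟨fun _ hA _ hα => isLinear_map_of_isFrobeniusTrivial C₁.opsData C₂.opsData h.Ψ.functor
      C₁.opsData_isOfFrobeniusNormalizedType hA hα,
    fun _ hA _ hα => isLinear_map_of_isFrobeniusTrivial C₂.opsData C₁.opsData h.Ψ.inverse
      C₂.opsData_isOfFrobeniusNormalizedType hA hα⟩

/-- **Reduction of the universal closure of F-2812 to its base-identity conjunct at Frobenius-trivial
objects**: for every `h`, if `Ψ` (resp. `Ψ⁻¹`) carries base-identity linear endomorphisms of Frobenius-trivial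
objects to BASE-IDENTITY endomorphisms, then it carries them into `O^▷(−)` (the degree conjunct being automatic).
[cite: MochizukiEtTh2009, Cor 3.8 p.81] -/
theorem mem_endSubmonoid_map_of_isFrobeniusTrivial {A : C₁.category} (hA : C₁.opsData.IsFrobeniusTrivial A)
    {α : End A} (hα : α ∈ C₁.opsData.endSubmonoid A)
    (hbase : C₂.opsData.IsBaseIdentity (h.Ψ.functor.map α)) :
    (h.Ψ.functor.map α : End (h.Ψ.functor.obj A)) ∈ C₂.opsData.endSubmonoid (h.Ψ.functor.obj A) :=
  ⟨hbase, isLinear_map_of_isFrobeniusTrivial C₁.opsData C₂.opsData h.Ψ.functor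
    C₁.opsData_isOfFrobeniusNormalizedType hA hα⟩

/-- **C38-L04, degree half, at the zero-class objects `(A_D, 0)`** (the Frobenius-trivial objects of the
proof of [FrdI] Thm. 5.2, p. 101), for every `h`: the Frobenius endomorphism `(2, id, 0, 0)` of `(A_D, 0)` is a
base-identity endomorphism of degree `2`, so `Ψ` carries `O^▷((A_D, 0))` into linear endomorphisms.
[cite: MochizukiEtTh2009, Cor 3.8 p.81] -/
theorem isLinear_map_of_cls_eq_one {A : C₁.category} (hA : A.cls = 1) {α : End A}
    (hα : α ∈ C₁.opsData.endSubmonoid A) : C₂.opsData.IsLinear (h.Ψ.functor.map α) := by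
  let φ : A ⟶ A :=
    { degFr := 2
      base := 𝟙 A.base
      div := 1
      unit := 1
      rel := by rw [hA, one_pow, map_one, map_one, map_one] }
  refine h.isLinear_map_of_mem_endSubmonoid (φ := φ) rfl ?_ hα
  change (2 : ℕ+) ≠ 1
  decide

end Cor38Hyp

end Rows

end Literature.AnabelianGeometry.EtaleTheta
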